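import Mathlib
import HarnessLib
import Summits.HubbardSuperconductivity.HubbardSuperconductivity.Theses.ChiralWindow
import Summits.HubbardSuperconductivity.HubbardSuperconductivity.Theorems.ChiralWindowCwChiralConstructionResidual
import Summits.HubbardSuperconductivity.HubbardSuperconductivity.Theorems.ChiralWindowCwChannelInfContinuousFilling

/-!
# Crux `CwChiralConstruction` (stmt-HubbardSuperconductivity-1740): transfer from an arbitrary certified level window

Route `HubbardSuperconductivity/ChiralWindow`, rank-2 crux ("the programme"). Support file
(`--supports stmt-HubbardSuperconductivity-1740`), line `ladder-scale-transfer` rev c5-1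
(`Cruxes/CwChiralConstruction/Lines/ladder_scale_transfer.lean`, lead c5, 2026-08-17).

rev c5-1 of the line hangs the Kohn–Luttinger input on ONE window doping (clause (i) of the kill switch
`CwKLChiralWindow`), which the landed stub `stub_klLeadingMuWindowOfPoint` turns into SOME level window `[μ₁, μ₂]` with
certified free fillings `13/25 < n(μ₁)`, `n(μ₂) < 7/10` — no longer the fixed window `[-169/200, -21/25]` of rev c4
(`cwChiralConstruction_of_orderFloorOnMuWindow`, p139489). This file records the corresponding record-free transfer for an
ARBITRARY such window, in the shape the RG chain delivers (floor on the operator levels `μ ∈ [μ₁ + U/2, μ₂]`, i.e.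
Grassmann levels `ν = μ - U/2 ∈ [μ₁, μ₂ - U/2]`):

* `cwChiralConstruction_of_orderFloorOnCertifiedLevelWindow` — if `μ₁ < μ₂`, `13/25 < n(μ₁)`, `n(μ₂) < 7/10` and for
  every `U ∈ (0, U₀)` the floor `e^{-C/U²} ≤ dWaveOrderParameter U μ` holds on `[μ₁ + U/2, μ₂]`, then `CwChiralConstruction`:
  for `U < μ₂ - μ₁` the open half-window `((μ₁+μ₂)/2, μ₂)` carries the floor, its closure has free fillings in
  `[13/25 + η, 7/10 - η]` with `η = min (n(μ₁) - 13/25) (7/10 - n(μ₂)) > 0` (`monotone_filling`), and c1's landed frame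
  `cwChiralConstruction_of_orderOnOpenSet` (generic-`μ` density via `cw_genericDensity`, p96959) concludes.

No definitions; everything is proved. [folklore: Griffiths 1964 + the cited tree lemmas]
-/

set_option linter.dupNamespace false

namespace Summit.HubbardSuperconductivity.HubbardSuperconductivity.Theorems

open Literature.MathematicalPhysics.QuantumLattice Filter
open Summit.HubbardSuperconductivity.HubbardSuperconductivity.Theses.ChiralWindow
open scoped Topology

/-- **Transfer from a level window with certified free fillings.** If `μ₁ < μ₂` have free fillings
`13/25 < n(μ₁)`, `n(μ₂) < 7/10`, and for every `U ∈ (0, U₀)` the floor `e^{-C/U²} ≤ dWaveOrderParameter U μ` holds on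
`[μ₁ + U/2, μ₂]`, then `CwChiralConstruction`: for `U < μ₂ - μ₁` the open half-window `((μ₁+μ₂)/2, μ₂)` carries the
floor, its closure has free fillings in `[13/25 + η, 7/10 - η]`, `η = min (n(μ₁) - 13/25) (7/10 - n(μ₂))`
(`monotone_filling`), and c1's landed frame `cwChiralConstruction_of_orderOnOpenSet` (generic-`μ` density,
`cw_genericDensity`) concludes. [folklore: Griffiths 1964 + landed tree lemmas] -/
theorem cwChiralConstruction_of_orderFloorOnCertifiedLevelWindow {μ₁ μ₂ : ℝ} (h12 : μ₁ < μ₂)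
    (hn₁ : 13 / 25 < KohnLuttinger.filling (squareDispersion 1 0) μ₁)
    (hn₂ : KohnLuttinger.filling (squareDispersion 1 0) μ₂ < 7 / 10)
    (h : ∃ U₀ C : ℝ, 0 < U₀ ∧ 0 < C ∧ ∀ U ∈ Set.Ioo (0:ℝ) U₀, ∀ μ ∈ Set.Icc (μ₁ + U / 2) μ₂,
      Real.exp (-C / U ^ 2) ≤ dWaveOrderParameter U μ) :
    CwChiralConstruction := by
  obtain ⟨U₀, C, hU₀, hC, H⟩ := h
  set η : ℝ := min (KohnLuttinger.filling (squareDispersion 1 0) μ₁ - 13 / 25)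
    (7 / 10 - KohnLuttinger.filling (squareDispersion 1 0) μ₂) with hηdef
  have hη : 0 < η := lt_min (by linarith) (by linarith)
  have hη₁ : η ≤ KohnLuttinger.filling (squareDispersion 1 0) μ₁ - 13 / 25 := min_le_left _ _
  have hη₂ : η ≤ 7 / 10 - KohnLuttinger.filling (squareDispersion 1 0) μ₂ := min_le_right _ _
  refine cwChiralConstruction_of_orderOnOpenSet
    ⟨η, min U₀ (μ₂ - μ₁), C, hη, lt_min hU₀ (by linarith), hC, fun U hU => ?_⟩
  have hUU₀ : U < U₀ := lt_of_lt_of_le hU.2 (min_le_left _ _)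
  have hUw : U < μ₂ - μ₁ := lt_of_lt_of_le hU.2 (min_le_right _ _)
  refine ⟨(μ₁ + μ₂) / 2, μ₂, by linarith, fun μ hμ => ?_, fun μ hμ => ?_⟩
  · have h1 : KohnLuttinger.filling (squareDispersion 1 0) μ₁ ≤
        KohnLuttinger.filling (squareDispersion 1 0) μ := monotone_filling (by linarith [hμ.1])
    have h2 : KohnLuttinger.filling (squareDispersion 1 0) μ ≤
        KohnLuttinger.filling (squareDispersion 1 0) μ₂ := monotone_filling hμ.2
    exact ⟨by linarith, by linarith⟩
  · exact H U ⟨hU.1, hUU₀⟩ μ ⟨by linarith [hμ.1], hμ.2.le⟩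

/-- **Registered sub-goal `stub_cruxOfOrderFloorOnCertifiedLevelWindow`** (arrow form of
`cwChiralConstruction_of_orderFloorOnCertifiedLevelWindow`, line `ladder-scale-transfer` rev c5-1): an order floor
`e^{-C/U²} ≤ dWaveOrderParameter U μ` on the operator levels `[μ₁ + U/2, μ₂]` of ANY level window with certified free
fillings `13/25 < n(μ₁)`, `n(μ₂) < 7/10`, for all `U ∈ (0, U₀)`, implies `CwChiralConstruction`.
[folklore: Griffiths 1964 + landed tree lemmas] -/
theorem stub_cruxOfOrderFloorOnCertifiedLevelWindow :
    ∀ μ₁ μ₂ : ℝ, μ₁ < μ₂ → 13 / 25 < KohnLuttinger.filling (squareDispersion 1 0) μ₁ → KohnLuttinger.filling (squareDispersion 1 0) μ₂ < 7 / 10 → (∃ U₀ C : ℝ, 0 < U₀ ∧ 0 < C ∧ ∀ U ∈ Set.Ioo (0:ℝ) U₀, ∀ μ ∈ Set.Icc (μ₁ + U / 2) μ₂, Real.exp (-C / U ^ 2) ≤ dWaveOrderParameter U μ) → CwChiralConstruction :=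
  fun _ _ h12 hn₁ hn₂ h => cwChiralConstruction_of_orderFloorOnCertifiedLevelWindow h12 hn₁ hn₂ h

end Summit.HubbardSuperconductivity.HubbardSuperconductivity.Theorems
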